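import Summits.Ventures.CertifiedManyBodySolver.Rows.CorrWindowCertKernelChainQuot
import HarnessLib

/-!
# The CLOSER of the hinted symmetry-quotient chain: geometry of the index letter map + the accepted moves as the Literature
# theorem's licensed family (companion of `Rows/CorrWindowCertKernelChainQuot.lean`)

HONEST FRAMING: Lean plumbing towards «tier P» (same status as the companion): here the ONLY place geometry enters — `d_gq` (the
index move `gq D γ v` IS `Γ(incl) ∘ Γ(d4Emb γ v Λ)` on letters, from the table specifications `xs`/`ix`/`xsβ`), the TABLE CRITERION
`shiftSet_subset_of_table` (every moved inner site read back by the outer tables ⇒ the moved inner window lies in the outer one),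
`termOp_symTL_eq` (a move list denotes what the kernel form's `symT` denotes), `termOp_residTG_moves`, and the closer
**`affineOrbitLowerRowN_of_quotChainKernelCertTB`**: data of `affineOrbitLowerRowN_of_chainKernelCertTB` with the symmetry block
(`γ, wv, g, SY, hγS, hsh, hg`) REPLACED by the tables + two decidable table facts `hokS`/`hokV` about the finitely many licensed
`(γ, v)`, the hint lists `Hs`, the chain facts `ChainQOK`, ONE rational inequality ⇒
`SquareTTPrimeCorrAffineOrbitLowerRowN tp U q hi lo κhi κlo s n₀ S Λ' (termOp d TX)` — the accepted hints across all steps ARE the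
licensed-move family of `affineOrbitLowerRowN_of_residPolyG` (p669665), built noncomputably from the data; the instance supplies no
symmetry data. Nothing of record moves; no claim node is discharged; CONTROL/CALIBRATION context (wording (xx1)); silent on the
presence of superconductivity; not a `T_c` or phase sentence; nothing about any material; no summit statement is proved by this file.
Seat hubbard-obs-p2 (STIFFNESS), `prover-hubbard-obs-p2-g23-0`, zero compute. STEP-0 instance:
`Certificates/HubbardSquare_tpm3o10_U29o5_toyKernelCert_bondRowQuot.lean`.

References: X. Han, arXiv:2006.06002 §3 [Han2020Bootstrap]; J. Wang et al., PRX 14 (2024) 031006 §III [WangEtAl2024]; C. Jansson,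
D. Chaykin, C. Keil, SIAM J. Numer. Anal. 46 (2008) 180 [JanssonChaykinKeil2008].
-/

namespace Summit.Ventures.CertifiedManyBodySolver

namespace CARPolyWindow

open Summit.Ventures.CertifiedQuantumChemistry Summit.Ventures.CertifiedQuantumChemistry.CARPoly
open Literature.MathematicalPhysics.QuantumLattice Literature.MathematicalPhysics.QuantumLattice.HubbardWave0
open Literature.MathematicalPhysics.QuantumManyBody.StateRelaxation
open Literature.Probability.LatticeModels ThermodynamicLimit Filter Topology
open Matrix
open scoped ComplexOrder BigOperators

/-! ## §1 Geometry: the index letter map IS the licensed move; the accepted family as a `symT` -/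

section Geometry

variable {N Nβ : ℕ}

/-- Membership-proof irrelevance for ordered sites. [folklore] -/
private theorem pt_congr_q {Λ : Finset (Site 2)} {x y : Site 2} (hx : x ∈ Λ) (hy : y ∈ Λ) (h : x = y) :
    PolySite.pt x hx = PolySite.pt y hy := by
  subst h; rfl

/-- A site read back by the tables lies in the outer window. [folklore] -/
theorem mem_of_table {Λ' : Finset (Site 2)} (D : QuotData N Nβ) (hxs : ∀ i, D.xs i ∈ Λ') {y : Site 2}
    (hy : D.xs (D.ix y) = y) : y ∈ Λ' := hy ▸ hxs _

/-- **TABLE CRITERION for a licensed move**: if every moved inner site is read back by the outer tables, the moved inner window lies in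
the outer window. [folklore] -/
theorem shiftSet_subset_of_table {Λ Λ' : Finset (Site 2)} (D : QuotData N Nβ) (hxs : ∀ i, D.xs i ∈ Λ')
    (hcovβ : ∀ x ∈ Λ, ∃ j, D.xsβ j = x) (γ : DihedralGroup 4) (v : Site 2)
    (htab : ∀ j : Fin Nβ, D.xs (D.ix (d4Vec γ (D.xsβ j) + v)) = d4Vec γ (D.xsβ j) + v) :
    d4ShiftSet γ v Λ ⊆ Λ' := by
  intro y hy
  rw [d4ShiftSet, Finset.mem_map] at hy
  obtain ⟨x, hx, rfl⟩ := hy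
  obtain ⟨j, rfl⟩ := hcovβ x hx
  exact mem_of_table D hxs (htab j)

/-- **The index letter map IS `Γ(incl) ∘ Γ(d4Emb γ v Λ)` on letters**, for a licensed move, from the table specifications.
[cite: Han2020Bootstrap, §3] -/
theorem d_gq {Λ Λ' : Finset (Site 2)} (D : QuotData N Nβ) (hxs : ∀ i, D.xs i ∈ Λ')
    (d : Orb (Fin N) → Orb (PolySite Λ')) (hdx : ∀ i σ, d (orb i σ) = orb (PolySite.pt (D.xs i) (hxs i)) σ)
    (hix : ∀ y ∈ Λ', D.xs (D.ix y) = y)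
    (hxsβ : ∀ j, D.xsβ j ∈ Λ) (dΛ : Orb (Fin Nβ) → Orb (PolySite Λ))
    (hdΛ : ∀ j σ, dΛ (orb j σ) = orb (PolySite.pt (D.xsβ j) (hxsβ j)) σ)
    (γ : DihedralGroup 4) (v : Site 2) (hsh : d4ShiftSet γ v Λ ⊆ Λ') (j : Fin Nβ) (σ : Fin 2) :
    d (gq D γ v (orb j σ)) = Orb.embMap (PolySite.incl hsh) (Orb.embMap (PolySite.d4Emb γ v Λ) (dΛ (orb j σ))) := by
  have hy : d4Vec γ (D.xsβ j) + v ∈ Λ' := hsh (d4Vec_add_mem_d4ShiftSet γ v (hxsβ j))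
  show d (orb (D.ix (d4Vec γ (D.xsβ j) + v)) σ) = _
  rw [hdx, pt_congr_q (hxs _) hy (hix _ hy), hdΛ]
  rfl

/-- Every letter is `orb` of its components. [folklore] -/
theorem orb_ofLex_eq {Λ : Type*} (b : Orb Λ) : orb (ofLex b).1 (ofLex b).2 = b := rfl

/-- **The symmetry list of a move list denotes what the kernel form's `symT` (indexed by positions) denotes.** [folklore] -/
theorem termOp_symTL_eq {ι : Type*} [LinearOrder ι] [Fintype ι] (d : Orb (Fin N) → ι) (f : Orb (Fin Nβ) → Orb (Fin N))
    (g : DihedralGroup 4 → Site 2 → Orb (Fin Nβ) → Orb (Fin N)) (L : List (Fin 8 × (ℤ × ℤ) × Terms (Orb (Fin Nβ)))) :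
    termOp d (symTL f g L) =
      termOp d (symT f (fun l : Fin L.length => g (d4OfCode (L.get l).1) (siteOfPair (L.get l).2.1)) (fun l => (L.get l).2.2)) := by
  rw [symTL, termOp_flatMap_get, symT, termOp_flatMap_finL]

/-- **The residual WITH the accepted family = the residual WITHOUT symmetry slices minus the family** (as operators).
[cite: WangEtAl2024, §III] -/
theorem termOp_residTG_moves {α β : Type*} {ι : Type*} [LinearOrder ι] [Fintype ι] (d : α → ι)
    (TX : Terms α) (μ : Fin 2 → ℚ) (ν : ℚ) (o : Fin 2 → α) (κhi hi κlo lo : ℚ) (TE : Terms α)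
    (TG : Terms α) (TH : Terms α) (f : β → α) (EB : List (Terms β))
    {nS : ℕ} (g : Fin nS → β → α) (SY : Fin nS → Terms β) (CW : Terms α) (AV : List (Terms α)) :
    termOp d (residTG TX μ ν o κhi hi κlo lo TE TG TH f EB g SY CW AV) =
      termOp d (residTG TX μ ν o κhi hi κlo lo TE TG TH f EB (fun l : Fin 0 => l.elim0) (fun l : Fin 0 => l.elim0) CW AV) -
        termOp d (symT f g SY) := by
  have h0 : symT f (fun l : Fin 0 => l.elim0) (fun l : Fin 0 => l.elim0) = ([] : Terms α) := rfl
  simp only [residTG, termOp_append, termOp_negT, h0, termOp_nil, neg_zero, add_zero]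
  abel

end Geometry

/-! ## §2 The closer -/

noncomputable section QuotCloser

variable {N Nβ : ℕ} [NeZero N]

/-- **HINTED-QUOTIENT STAGED KERNEL FORM, TWO-LEVEL GRAM: a hinted merge chain over the regrouped sliced residual WITHOUT symmetry
slices (the symmetry family is built from the ACCEPTED hints), started from the empty accumulator, + the table facts of the geometry
+ `q ≤ lowerConst (decPoly N C_M) + (Σμ)(n₀/2 − ν)` ⇒ `SquareTTPrimeCorrAffineOrbitLowerRowN tp U q hi lo κhi κlo s n₀ S Λ' (termOp d TX)`.**
[cite: WangEtAl2024, §III] [cite: Han2020Bootstrap, §3] [cite: JanssonChaykinKeil2008, §3] -/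
theorem affineOrbitLowerRowN_of_quotChainKernelCertTB
    (tp U : ℚ) (hU : 0 ≤ U)
    {Λ Λ' : Finset (Site 2)} (hΛ : Λ ⊆ Λ') (h8 : thicken Λ 1 ⊆ Λ')
    (h0 : thicken ({0} : Finset (Site 2)) 1 ⊆ Λ') (hz : (0 : Site 2) ∈ Λ')
    {S : Finset (DihedralGroup 4)} (h1 : (1 : DihedralGroup 4) ∈ S) (hmul : ∀ a ∈ S, ∀ b ∈ S, a * b ∈ S)
    -- tables and letters
    (D : QuotData N Nβ) (hxs : ∀ i, D.xs i ∈ Λ') (hix : ∀ y ∈ Λ', D.xs (D.ix y) = y)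
    (hxsβ : ∀ j, D.xsβ j ∈ Λ) (hcovβ : ∀ x ∈ Λ, ∃ j, D.xsβ j = x)
    (d : Orb (Fin N) → Orb (PolySite Λ')) (hd : Function.Injective d)
    (hdx : ∀ i σ, d (orb i σ) = orb (PolySite.pt (D.xs i) (hxs i)) σ) (Bkey : ℕ)
    (dΛ : Orb (Fin Nβ) → Orb (PolySite Λ)) (hdΛ : ∀ j σ, dΛ (orb j σ) = orb (PolySite.pt (D.xsβ j) (hxsβ j)) σ)
    (hf : ∀ b, d (D.f b) = Orb.embMap (PolySite.incl hΛ) (dΛ b))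
    (sp : Orb (Fin N) → Fin 2) (hsp : ∀ a, (ofLex (d a)).2 = sp a)
    -- licensed moves: every `ok` code is in `S`, every `ok` move keeps the inner window inside the outer one (table form)
    (hokS : ∀ γc v, D.ok γc v = true → d4OfCode γc ∈ S)
    (hokV : ∀ γc v, D.ok γc v = true →
      ∀ j : Fin Nβ, D.xs (D.ix (d4Vec (d4OfCode γc) (D.xsβ j) + siteOfPair v)) = d4Vec (d4OfCode γc) (D.xsβ j) + siteOfPair v)
    -- dictionaries
    (TH : Terms (Orb (Fin N))) (hH : termOp d TH = (hubbardTTPrimeFermionInteraction 1 tp U).localHamiltonian Λ')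
    (TE : Terms (Orb (Fin N)))
    (hE : termOp d TE = fermionEmbed (PolySite.incl h0) ((hubbardTTPrimeFermionInteraction 1 tp U).meanEnergyObs 1))
    (o : Fin 2 → Orb (Fin N)) (ho : ∀ σ, d (o σ) = orb (PolySite.pt 0 hz) σ)
    -- certificate data (no symmetry family: it rides as hints)
    (TX : Terms (Orb (Fin N))) (μ : Fin 2 → ℚ) (ν κhi hi κlo lo : ℚ) (K : ℕ)
    (blocks : List (List (List ℤ × Terms (Orb (Fin N))))) (EB : List (Terms (Orb (Fin Nβ))))
    (CW : Terms (Orb (Fin N))) (hcw : ∀ wc ∈ CW, chargeW wc.1 ≠ 0 ∨ spinChargeW sp wc.1 ≠ 0)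
    (AV : List (Terms (Orb (Fin N))))
    -- the hinted chain
    (ns : List ℕ) (M : ℕ) (Cs : List SOSDual.EncPoly) (hC0 : Cs.getD 0 [] = []) (Hs : List (List (QHint Nβ)))
    (hchain : ChainQOK D Bkey M Cs
      (groupSlices (residTGslices TX μ ν o κhi hi κlo lo TE (gramTBslices K blocks) TH D.f EB
        (fun l : Fin 0 => l.elim0) (fun l : Fin 0 => l.elim0) CW AV) ns) Hs)
    -- the ONE rational inequality on the last accumulator
    {q s n₀ : ℚ} (hs : s = (μ 0 + μ 1) / 2)
    (hq : q ≤ lowerConst (SOSDual.decPoly N (Cs.getD M [])) + (μ 0 + μ 1) * (n₀ / 2 - ν)) :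
    SquareTTPrimeCorrAffineOrbitLowerRowN (tp : ℝ) (U : ℝ) q hi lo κhi κlo s n₀ S Λ' (termOp d TX) := by
  -- the accepted move family
  set Ts := groupSlices (residTGslices TX μ ν o κhi hi κlo lo TE (gramTBslices K blocks) TH D.f EB
    (fun l : Fin 0 => l.elim0) (fun l : Fin 0 => l.elim0) CW AV) ns with hTs
  set L := allMoves D Bkey Ts Hs M with hL
  -- every accepted move is licensed
  have hLok : ∀ n, ∀ mv ∈ allMoves D Bkey Ts Hs n, D.ok mv.1 mv.2.1 = true := by
    intro n
    induction n with
    | zero => intro mv hmv; rw [allMoves_zero] at hmv; exact absurd hmv List.not_mem_nil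
    | succ n ih =>
      intro mv hmv
      rw [allMoves_succ, List.mem_append] at hmv
      rcases hmv with hmv | hmv
      · exact ih mv hmv
      · rw [movesOf, quotMoves, List.mem_filterMap] at hmv
        obtain ⟨a, ha, hmap⟩ := hmv
        obtain ⟨e, hae, hFe⟩ := Option.map_eq_some_iff.1 hmap
        obtain ⟨hok, -, -⟩ := annotate_ok D Bkey _ _ a ha e hae
        rw [← hFe]
        exact hok
  let γf : Fin L.length → DihedralGroup 4 := fun l => d4OfCode (L.get l).1
  let wvf : Fin L.length → Site 2 := fun l => siteOfPair (L.get l).2.1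
  let gf : Fin L.length → Orb (Fin Nβ) → Orb (Fin N) := fun l => gq D (γf l) (wvf l)
  let SYf : Fin L.length → Terms (Orb (Fin Nβ)) := fun l => (L.get l).2.2
  have hγS : ∀ l, γf l ∈ S := fun l => hokS _ _ (hLok M _ (List.get_mem L l))
  have hsh : ∀ l, d4ShiftSet (γf l) (wvf l) Λ ⊆ Λ' := fun l =>
    shiftSet_subset_of_table D hxs hcovβ (γf l) (wvf l) (hokV _ _ (hLok M _ (List.get_mem L l)))
  have hg : ∀ l b, d (gf l b) = Orb.embMap (PolySite.incl (hsh l)) (Orb.embMap (PolySite.d4Emb (γf l) (wvf l) Λ) (dΛ b)) :=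
    fun l b => by rw [← orb_ofLex_eq b]; exact d_gq D hxs d hdx hix hxsβ dΛ hdΛ (γf l) (wvf l) (hsh l) _ _
  -- the semantic residual hypothesis WITH the accepted family
  have hTG : termOp d (gramTBslices K blocks).flatten = gramForm (gramTBCoef K blocks) (gramTBOp d blocks) := by
    rw [flatten_gramTBslices, termOp_gramTB_eq_gramForm]
  have hRsem : evalPoly d (SOSDual.decPoly N (Cs.getD M [])) =
      termOp d (residTG TX μ ν o κhi hi κlo lo TE (gramTBslices K blocks).flatten TH D.f EB gf SYf CW AV) := by
    rw [evalPoly_chainQ_nil hd hC0 hchain, hTs, flatten_groupSlices, flatten_residTGslices,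
      termOp_residTG_moves d TX μ ν o κhi hi κlo lo TE _ TH D.f EB gf SYf CW AV, ← hL, termOp_symTL_eq]
  exact affineOrbitLowerRowN_of_residPolyG tp U hU hΛ h8 h0 hz h1 hmul d dΛ D.f hf sp hsp TH hH TE hE o ho TX μ ν κhi hi κlo lo
    (gramTBslices K blocks).flatten (gramTBCoef_posSemidef K blocks) (gramTBOp d blocks) hTG EB γf hγS wvf hsh gf hg SYf CW hcw
    AV hRsem hs hq

end QuotCloser

end CARPolyWindow

end Summit.Ventures.CertifiedManyBodySolver
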